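import Summits.BirchSwinnertonDyer.BirchSwinnertonDyer.Theorems.ByReductionTypeAtTwoRankOneAtTwoBigImageOddLocalOneDoorIndexLawOfKolyvaginExact
import Summits.BirchSwinnertonDyer.BirchSwinnertonDyer.Theorems.ByReductionTypeAtTwoRankOneAtTwoBigImageOddLocalOneDoorFullC
import Summits.BirchSwinnertonDyer.BirchSwinnertonDyer.Theorems.ByReductionTypeAtTwoRankOneAtTwoBigImageOddLocalOneDoorTamagawa
import Summits.BirchSwinnertonDyer.BirchSwinnertonDyer.Theorems.ByReductionTypeAtTwoRankOneAtTwoOneDoorLawCDefs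
import Literature.NumberTheory.Automorphic.ShimuraCurveRibetTakahashiOptimalProofs
import HarnessLib

/-!
# Route ByReductionTypeAtTwo, crux `RankOneAtTwoBigImageOddLocal` (stmt-BirchSwinnertonDyer-23715):
# the K-side bridge with the PARAMETRISATION CONSTANT FLOATING (Manin-free), and AN-28c downstream of it

Width prover seat `bsd-line-fkl-p2` g7 (2026-08-28), answer to the LEAD's 09:47:57Z ask («the supply binder still asks an odd-constant
`Dt` — carry `2·v₂(Dt.c)` next to `M₀`»); `--supports stmt-BirchSwinnertonDyer-23715`.  THEOREMS ONLY; nothing asserted; BSD is not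
proved by any of this.

The K-side bridge (`…OneDoorKolyvaginExactBridge[Supply].lean`, p621371/p622543) goes through the sibling cell's exact descent
`CMExactDescent.bsdp_two_of_card_sha_baseChange_eq_of_facts`, which assumes an ODD constant `c = Dt.c` to read the Gross–Zagier identity
over `K`, `#Ш_an(E_K) = 4 I² / (c² w_K² (∏ c_ℓ)²)` (`shaAnOverC_baseChange_eq_of_heegner`, itself valid for ANY `c ≠ 0`), as
`ord₂ #Ш_an(E_K) = 2 M₀`.  With `c` floating the same identity reads `ord₂ #Ш_an(E_K) = 2 M₀ − 2 v₂(c)` (`M₀ = ord₂ [E(K):ℤ y_K]`,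
the exact `2`-divisibility exponent of `y_K = P(1)`), so the K-side exactness input must be carried as
**`ord₂ #Ш(E_K)[2^∞] + 2 v₂(c) = 2 M₀`** — the c-corrected `2`-part of Gross's Conjecture (2.2) over `K`.  (Route GenusKolyvaginAtTwo's
crux `KolyvaginExactAtTwo` concludes `#Ш(E_K)[2^∞] = 4^{M₀}` for every datum, i.e. it is the odd-`c` case; at a datum with even constant
the two differ.)  Contents:

* §1 `bsdp_two_of_card_sha_baseChange_eq_C` — the exact descent with `c` FLOATING: `W` globally minimal, `ρ̄_{W,2}` onto, odd `∏ c_ℓ`,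
  `r_an(W) ≤ 1`; `K` with odd `d_K ≠ −3` and the Heegner hypothesis; ANY datum `Dt`; conductor-`1` datum `d₁` with `2^{M₀} ∥ P(1)`;
  `ord_{s=1} L(E_K,s) = 1`; `ord₂ #Ш(E_K)[2^∞] + 2 v₂(c) = 2 M₀`; `Wd` minimal twin with `r_an ≤ 1` and `BSD(Wd,2)` ⟹ `BSD(W,2)`, modulo
  Gross–Zagier, GZK, modularity, Milne 1972 (proof = the sibling's, p582452, with `v₂ c` carried); §2 `…_C_rankOne` (`r_an(W) = 1`,
  `y_K` non-torsion).
* §3 `bsdp_two_of_shaExactC_at` — PER DATUM on the slice of 23715 (no Manin, no odd torsion).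
* §4 `rankOneAtTwoBigImageOddLocal_of_shaExactCAtTwo` — the crux BY NAME from PRINT (`gross_zagier`, GZK, `exists_isNewformOf`,
  Hoffstein–Luo, Milne) + ONE K-side binder `hXC` (c-corrected exactness at conductor `1` on the slice's Kolyvagin-admissible doors:
  for every datum of any constant and conductor-`1` datum with `y_K` of infinite order and exact exponent `M₀`,
  `ord₂ #Ш(E_K)[2^∞] + 2 v₂(c) = 2 M₀`) + `S_rankZeroTwin`.  NO `S_manin`, NO Kolyvagin-conjecture binder (the datum is modularity's,
  `nonempty_modularParametrizationData_iff_exists_isNewformOf_unconditional`).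
* §5 `doorIndexLawFullCAtTwo_of_bsdp` / `doorIndexLawFullCAtTwo_of_shaExactCAtTwo` — the Manin-free E-side conjecture AN-28c
  (`DoorIndexLawFullCAtTwo`, lead p621906) from `BSD₂` on the slice (the `→` direction of the lead's `bsdp_two_iff_doorLawFullC_at`,
  p621746), hence from the K-side binder `hXC`.

Net Manin-free K-side cone of 23715: {PRINT⁵ incl. Milne 1972, `hXC` (2-part of Gross (2.2) over `K`, c-corrected, conductor 1),
rank-`0` cruxes}; and `hXC ⇒ AN-28c` modulo the same.  Nothing here is asserted.

References: [GrossZagier1986] V.§2; [GrossLMS1991] §2 Conj. (2.2), §4; [McCallumLMS1991] §5 Lemma 5.1; [Milne1972ArithmeticAV] §1 Thm. 1;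
[Miller2011LMS] Def. 1.1.
-/

set_option autoImplicit false
-- the Theorems namespace of this sub repeats the summit name by design (D-0017 nested layout)
set_option linter.dupNamespace false

noncomputable section

open scoped Classical

namespace Summit.BirchSwinnertonDyer.BirchSwinnertonDyer.Theorems.RankOneAtTwoOneDoor

open WeierstrassCurve NumberField Literature.NumberTheory.EllipticCurves Literature.NumberTheory.EllipticCurves.ModularForms
  Literature.NumberTheory.EllipticCurves.Rank1Residual
  Literature.NumberTheory.EllipticCurves.Rank1Residual.Typed
  Literature.NumberTheory.EllipticCurves.KrizLi2019
  Summit.BirchSwinnertonDyer.Rank1Residual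
  Summit.BirchSwinnertonDyer.Rank1Residual.AdditivePotMult
  Summit.BirchSwinnertonDyer.Rank1Residual.F1Sign2
  Summit.BirchSwinnertonDyer.Rank1Residual.F1Sign2.TranspositionDoor
  Summit.BirchSwinnertonDyer.BirchSwinnertonDyer.Theses.ByReductionTypeAtTwo
  Summit.BirchSwinnertonDyer.BirchSwinnertonDyer.Theorems.CMExactDescent

/-! ### §1 The exact `2`-adic Heegner descent with the parametrisation constant floating -/

/-- **THE EXACT `2`-ADIC HEEGNER DESCENT, CONSTANT FLOATING.**  As `CMExactDescent.bsdp_two_of_card_sha_baseChange_eq_of_facts`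
(p582452) with the binder `Odd Dt.c` dropped and the exactness hypothesis c-corrected: `W/ℚ` globally minimal with `ρ̄_{W,2}` onto
(`hρ`), `∏ c_ℓ` odd (`hT`), `r_an(W) ≤ 1` (`hr`); `K` imaginary quadratic with odd `d_K ≠ −3` (`w_K = 2`) and the Heegner hypothesis;
`Dt` ANY datum (`c ≠ 0` by `maninConstant_ne_zero_holds`); `d₁` conductor-`1` with `2^{M₀} ∥ P(1)`; `ord_{s=1} L(E_K,s) = 1` (`hrK`);
`ord₂ #Ш(E_K)[2^∞] + 2 v₂(c) = 2 M₀` (`hshaC`); `Wd` a globally minimal model of the twist with `r_an ≤ 1` and `BSD(Wd,2)`.  PRINT binders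
`hGZ`, `hGZK`, `hmod`, `hMilneC`.  THEN `BSD(W, 2)`: `#Ш_an(W ⊗ K) = 4I²/(c² w² (∏c)²)` has `ord₂ = 2M₀ − 2v₂(c) = ord₂ #Ш(W ⊗ K)`, i.e.
`MissingPPartOverCAt (W ⊗ K) 2`, and `AdditivePotMult.bsdp_of_pPartOverC_baseChange` concludes.
[cite: GrossZagier1986, V.§2 (pp. 310–312)] [cite: McCallumLMS1991, §5 Lemma 5.1] [cite: Milne1972ArithmeticAV, §1 Thm. 1]
[cite: Miller2011LMS, Def. 1.1] -/
theorem bsdp_two_of_card_sha_baseChange_eq_C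
    (W : WeierstrassCurve ℚ) [W.IsElliptic] [W.IsGloballyMinimal] [NeZero (W.conductorNorm ℤ)]
    (K : Type) [Field K] [NumberField K]
    (Dt : ModularParametrizationData W (W.conductorNorm ℤ)) (β : ℤ) (ι : K →+* ℂ) (d₁ : KolyvaginHeegnerData Dt β ι 1)
    (Wd : WeierstrassCurve ℚ) [Wd.IsElliptic] [Wd.IsGloballyMinimal]
    (hGZ : gross_zagier (W.conductorNorm ℤ) W K)
    (hGZK : rank_eq_analyticRank_of_analyticRank_le_one) (hmod : hasEntireLFunction_rat)
    (hMilneC : Milne1972.bsdQuotient_baseChange_quadratic_anyModel)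
    (hρ : W.HasSurjectiveModNGaloisRep 2) (hT : Odd W.tamagawaProduct) (hr : W.analyticRank ≤ 1)
    (hK : IsImaginaryQuadratic K) (hodd : Odd (NumberField.discr K)) (h3 : NumberField.discr K ≠ -3)
    (hH : SatisfiesHeegnerHypothesis (W.conductorNorm ℤ) K)
    (hrK : (W.baseChange K).analyticRank = 1) {M₀ : ℕ}
    (hdiv : ∃ Q : (W.baseChange (ringClassField K ι 1)).toAffine.Point, ((2 ^ M₀ : ℕ) : ℤ) • Q = d₁.derivedPoint)
    (hndiv : ¬ ∃ Q : (W.baseChange (ringClassField K ι 1)).toAffine.Point, ((2 ^ (M₀ + 1) : ℕ) : ℤ) • Q = d₁.derivedPoint)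
    (hshaC : (padicValNat 2 (Nat.card (AddCommGroup.primaryComponent (W.baseChange K).sha 2)) : ℤ) +
      2 * padicValInt 2 Dt.c = 2 * M₀)
    (hWd : ∃ C : VariableChange ℚ, C • W.quadraticTwist (NumberField.discr K : ℚ) = Wd)
    (hrd : Wd.analyticRank ≤ 1) (hBd : BSDp Wd 2) : BSDp W 2 := by
  haveI : Fact (Nat.Prime 2) := ⟨Nat.prime_two⟩
  haveI hEK : (W.baseChange K).IsElliptic := isElliptic_baseChange' W K
  have h2 : Module.finrank ℚ K = 2 := hK.1
  obtain ⟨-, hDlt⟩ := discr_emod_four_and_lt_of_odd hK hodd h3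
  have hw2 : Units.torsionOrder K = 2 :=
    Literature.NumberTheory.QuadraticFields.Quadratic.torsionOrder_eq_two_of_discr_lt_neg_four h2 hDlt
  have hc0 : Dt.c ≠ 0 := Dt.maninConstant_ne_zero_holds
  -- the Heegner point `P₀ ∈ E(K)` below `P(1)`, for the datum `Dt`
  obtain ⟨P₀, Hd, hP₀, hP₀K⟩ := exists_heegnerPoint_map_eq_derivedPoint_one hK hH d₁
  -- the exact identity over `K` (any constant)
  obtain ⟨hrkK, hShaK, hPinf, hshaCx⟩ := shaAnOverC_baseChange_eq_of_heegner W K Dt Hd ι P₀ hGZ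
    hGZK hmod hK hH hP₀ hc0 hrK
  haveI hfinK : Finite (W.baseChange K).sha := hShaK
  -- `ord₂ [E(K) : ℤP₀] = M₀`
  have htor1 : ∀ (M : ℕ) (R : (W.baseChange (ringClassField K ι 1)).toAffine.Point),
      ((2 ^ M : ℕ) : ℤ) • R = 0 → R = 0 :=
    fun M R hR ↦ eq_zero_of_two_pow_smul_eq_zero_ringClassField W hK hodd hH hρ ι M R hR
  have hdivK : ∃ Q : (W.baseChange K).toAffine.Point, ((2 ^ M₀ : ℕ) : ℤ) • Q = P₀ :=
    (X11b.Three.Koly.pDiv_one_iff_exists_zsmul_eq hK d₁ P₀ hP₀K 2 M₀ (htor1 M₀)).mp hdiv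
  have hndivK : ¬ ∃ Q : (W.baseChange K).toAffine.Point, ((2 ^ (M₀ + 1) : ℕ) : ℤ) • Q = P₀ :=
    fun h ↦ hndiv ((X11b.Three.Koly.pDiv_one_iff_exists_zsmul_eq hK d₁ P₀ hP₀K 2 (M₀ + 1)
      (htor1 (M₀ + 1))).mpr h)
  have hiv : ∀ x : (W.baseChange K).toAffine.Point, 2 • x = 0 → x = 0 :=
    fun x hx ↦ eq_zero_of_two_smul_eq_zero_baseChange W hK hodd hH hρ x hx
  haveI : Finite (AddCommGroup.torsion (W.baseChange K).toAffine.Point) :=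
    WeierstrassCurve.finite_torsion_point (W := W.baseChange K)
  obtain ⟨cc, Q, hcQ, hcker⟩ :=
    X11b.RankOne.exists_coord_of_mordellWeilRank_eq_one (W.baseChange K) hrkK
  have hidx : padicValNat 2 (AddSubgroup.zmultiples P₀).index = M₀ :=
    X11b.Three.Koly.padicValNat_index_zmultiples_eq_of_divisibility (p := 2) cc Q hcQ hcker hiv P₀
      hdivK hndivK
  -- `ord₂ #Ш_an(W ⊗ K) = 2 M₀ − 2 v₂(c) = ord₂ #Ш(W ⊗ K)`
  set I := (AddSubgroup.zmultiples P₀).index with hI_def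
  have hI0 : I ≠ 0 := fun hI ↦ by
    have hh := P2.torsionOrder_sq_mul_canonicalHeight_eq_index_sq_mul_regulator (W.baseChange K)
      hrkK P₀ hPinf
    rw [← hI_def, hI, Nat.cast_zero, zero_pow two_ne_zero, zero_mul, mul_eq_zero,
      pow_eq_zero_iff two_ne_zero, Nat.cast_eq_zero] at hh
    exact hh.elim (W.baseChange K).torsionOrder_pos_holds.ne'
      (fun h0 ↦ hPinf ((Affine.Point.canonicalHeight_eq_zero_iff_holds P₀).mp h0))
  set q : ℚ := 4 * (I : ℚ) ^ 2 /
      ((Dt.c : ℚ) ^ 2 * (Units.torsionOrder K : ℚ) ^ 2 * ((W.tamagawaProduct : ℚ) ^ 2)) with hq_def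
  have hcQ0 : (Dt.c : ℚ) ≠ 0 := by exact_mod_cast hc0
  have hcW0 : (W.tamagawaProduct : ℚ) ≠ 0 := by exact_mod_cast W.tamagawaProduct_pos_holds.ne'
  have hIQ0 : (I : ℚ) ≠ 0 := by exact_mod_cast hI0
  have hq' : q = ((I : ℚ) / ((Dt.c : ℚ) * (W.tamagawaProduct : ℚ))) ^ 2 := by
    rw [hq_def, hw2]
    push_cast
    field_simp
    ring
  have hvc : padicValRat 2 (Dt.c : ℚ) = padicValInt 2 Dt.c := padicValRat.of_int
  have hvcW : padicValRat 2 (W.tamagawaProduct : ℚ) = 0 := by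
    rw [padicValRat.of_nat, padicValNat.eq_zero_of_not_dvd hT.not_two_dvd_nat]
    rfl
  have hval : padicValRat 2 q = 2 * (M₀ : ℤ) - 2 * padicValInt 2 Dt.c := by
    rw [hq', padicValRat.pow, padicValRat.div hIQ0 (mul_ne_zero hcQ0 hcW0),
      padicValRat.mul hcQ0 hcW0, hvc, hvcW, padicValRat.of_nat, hidx]
    push_cast
    ring
  have hshaV : (padicValNat 2 (W.baseChange K).shaOrder : ℤ) = 2 * (M₀ : ℤ) - 2 * padicValInt 2 Dt.c := by
    rw [X11b.Three.Koly.padicValNat_shaOrder_eq (W.baseChange K) 2]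
    omega
  have hKin : MissingPPartOverCAt (W.baseChange K) 2 := ⟨q, hshaCx, by rw [hval, hshaV]⟩
  exact bsdp_of_pPartOverC_baseChange W 2 K Wd hGZK hmod hMilneC hr h2 hWd hrd hKin hBd

/-! ### §2 The rank-one member -/

/-- **The rank-ONE member, constant floating**: `r_an(W) = 1` and `y_K = P(1)` of infinite order give `L'(W/K,1) ≠ 0` (Gross–Zagier at
the Heegner point below `P(1)`), so the twist has analytic rank `0`, `ord_{s=1} L(E_K, s) = 1`, and §1 applies.
[cite: GrossZagier1986, V.§2 (p. 312)] [cite: Miller2011LMS, Def. 1.1] -/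
theorem bsdp_two_of_card_sha_baseChange_eq_C_rankOne
    (W : WeierstrassCurve ℚ) [W.IsElliptic] [W.IsGloballyMinimal] [NeZero (W.conductorNorm ℤ)]
    (K : Type) [Field K] [NumberField K]
    (Dt : ModularParametrizationData W (W.conductorNorm ℤ)) (β : ℤ) (ι : K →+* ℂ) (d₁ : KolyvaginHeegnerData Dt β ι 1)
    (Wd : WeierstrassCurve ℚ) [Wd.IsElliptic] [Wd.IsGloballyMinimal]
    (hGZ : gross_zagier (W.conductorNorm ℤ) W K)
    (hGZK : rank_eq_analyticRank_of_analyticRank_le_one) (hmod : hasEntireLFunction_rat)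
    (hMilneC : Milne1972.bsdQuotient_baseChange_quadratic_anyModel)
    (hρ : W.HasSurjectiveModNGaloisRep 2) (hT : Odd W.tamagawaProduct) (hr : W.analyticRank = 1)
    (hK : IsImaginaryQuadratic K) (hodd : Odd (NumberField.discr K)) (h3 : NumberField.discr K ≠ -3)
    (hH : SatisfiesHeegnerHypothesis (W.conductorNorm ℤ) K)
    (hy : ¬ IsOfFinAddOrder d₁.derivedPoint) {M₀ : ℕ}
    (hdiv : ∃ Q : (W.baseChange (ringClassField K ι 1)).toAffine.Point, ((2 ^ M₀ : ℕ) : ℤ) • Q = d₁.derivedPoint)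
    (hndiv : ¬ ∃ Q : (W.baseChange (ringClassField K ι 1)).toAffine.Point, ((2 ^ (M₀ + 1) : ℕ) : ℤ) • Q = d₁.derivedPoint)
    (hshaC : (padicValNat 2 (Nat.card (AddCommGroup.primaryComponent (W.baseChange K).sha 2)) : ℤ) +
      2 * padicValInt 2 Dt.c = 2 * M₀)
    (hWd : ∃ C : VariableChange ℚ, C • W.quadraticTwist (NumberField.discr K : ℚ) = Wd)
    (hBd : BSDp Wd 2) : BSDp W 2 := by
  have h2 : Module.finrank ℚ K = 2 := hK.1
  have hD0 : (NumberField.discr K : ℚ) ≠ 0 := by exact_mod_cast NumberField.discr_ne_zero K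
  haveI hEt : (W.quadraticTwist (NumberField.discr K : ℚ)).IsElliptic := W.isElliptic_quadraticTwist hD0
  obtain ⟨P₀, Hd, hP₀, hP₀K⟩ := exists_heegnerPoint_map_eq_derivedPoint_one hK hH d₁
  have hPinf : ¬ IsOfFinAddOrder P₀ := by
    intro hfin
    apply hy
    rw [← hP₀K]
    exact (WeierstrassCurve.Affine.Point.map (W' := W) (algebraMap K (ringClassField K ι 1)).toRatAlgHom).isOfFinAddOrder hfin
  have hLK : LDerivEK W K ≠ 0 :=
    (lDerivEK_ne_zero_iff_not_isOfFinAddOrder W (W.conductorNorm ℤ) K hGZ hK hH ⟨Dt, Hd, ι, hP₀⟩).mpr hPinf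
  have hL0 : W.entireLFunction 1 = 0 := entireLFunction_one_eq_zero_of_analyticRank_eq_one hr
  have hLt : (W.quadraticTwist (NumberField.discr K : ℚ)).entireLFunction 1 ≠ 0 := by
    intro h0
    apply hLK
    rw [lDerivEK_eq_deriv_mul W K hmod hL0, h0, mul_zero]
  have hrt : (W.quadraticTwist (NumberField.discr K : ℚ)).analyticRank = 0 :=
    ((W.quadraticTwist _).analyticRank_eq_zero_iff_holds (hmod _)).mpr hLt
  have hrd : Wd.analyticRank = 0 := by
    obtain ⟨Cd, hCd⟩ := hWd
    rw [← hCd, analyticRank_smul, hrt]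
  have hrK : (W.baseChange K).analyticRank = 1 :=
    (P2.analyticRank_baseChange_eq_one_iff W K hmod h2).mpr (Or.inl ⟨hr, hrt⟩)
  exact bsdp_two_of_card_sha_baseChange_eq_C W K Dt β ι d₁ Wd hGZ hGZK hmod hMilneC hρ hT hr.le hK hodd h3 hH hrK hdiv hndiv
    hshaC hWd (by rw [hrd]; exact zero_le_one) hBd

/-! ### §3 Per datum on the slice: no Manin, no odd torsion -/

/-- **`BSD(W, 2)` on the slice from the c-corrected K-side exactness at ONE datum of ANY constant.**  `W` globally minimal, non-CM,
`ρ_{W,2^n}` onto, odd `∏ c_ℓ`, `r_an = 1`; `K` with odd `d_K ≠ −3` and the Heegner hypothesis; ANY datum `Dt`, `β`, `ι`, conductor-`1`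
datum with `y_K` non-torsion and `2^{M₀} ∥ y_K`; `ord₂ #Ш(E_K)[2^∞] + 2 v₂(c) = 2 M₀`.  Then PRINT⁴ (`hGZ`, `hGZK`, `hmod`, `hMilneC`) and
`S_rankZeroTwin` give `BSD(W, 2)` (the minimal twin is non-CM of analytic rank `0`). [cite: GrossLMS1991, §2 Conj. (2.2)]
[cite: Milne1972ArithmeticAV, §1 Thm. 1] -/
theorem bsdp_two_of_shaExactC_at
    (hGZ : ∀ (N : ℕ) [NeZero N] (W : WeierstrassCurve ℚ) (K : Type) [Field K] [NumberField K], gross_zagier N W K)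
    (hGZK : rank_eq_analyticRank_of_analyticRank_le_one) (hmod : hasEntireLFunction_rat)
    (hMilneC : Milne1972.bsdQuotient_baseChange_quadratic_anyModel) (hZ : S_rankZeroTwin)
    (W : WeierstrassCurve ℚ) [W.IsElliptic] [W.IsGloballyMinimal] [NeZero (W.conductorNorm ℤ)]
    (hCM : ¬ W.HasCM) (hsurj : ∀ n : ℕ, W.HasSurjectiveModNGaloisRep ((2 ^ n : ℕ) : ℤ)) (hc : Odd W.tamagawaProduct)
    (hr : W.analyticRank = 1)
    (K : Type) [Field K] [NumberField K] (hK : IsImaginaryQuadratic K) (hodd : Odd (NumberField.discr K))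
    (h3 : NumberField.discr K ≠ -3) (hH : SatisfiesHeegnerHypothesis (W.conductorNorm ℤ) K)
    (Dt : ModularParametrizationData W (W.conductorNorm ℤ)) (β : ℤ) (ι : K →+* ℂ)
    (d₁ : KolyvaginHeegnerData Dt β ι 1) (hy : ¬ IsOfFinAddOrder d₁.derivedPoint) (M₀ : ℕ)
    (hdiv : ∃ Q : (W.baseChange (ringClassField K ι 1)).toAffine.Point, ((2 ^ M₀ : ℕ) : ℤ) • Q = d₁.derivedPoint)
    (hndiv : ¬ ∃ Q : (W.baseChange (ringClassField K ι 1)).toAffine.Point,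
      ((2 ^ (M₀ + 1) : ℕ) : ℤ) • Q = d₁.derivedPoint)
    (hshaC : (padicValNat 2 (Nat.card (AddCommGroup.primaryComponent (W.baseChange K).sha 2)) : ℤ) +
      2 * padicValInt 2 Dt.c = 2 * M₀) :
    BSDp W 2 := by
  have hρ2 : W.HasSurjectiveModNGaloisRep 2 := by
    have h := hsurj 1
    norm_num at h
    exact h
  -- the twin: a globally minimal model, non-CM, of analytic rank `0`; its `BSD₂` from the rank-`0` statement
  have hD0 : (NumberField.discr K : ℚ) ≠ 0 := by exact_mod_cast NumberField.discr_ne_zero K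
  haveI hEt : (W.quadraticTwist (NumberField.discr K : ℚ)).IsElliptic := W.isElliptic_quadraticTwist hD0
  obtain ⟨Cd, hCd⟩ := hasGlobalMinimalModel_rat_holds (W.quadraticTwist (NumberField.discr K : ℚ))
  haveI : (Cd • W.quadraticTwist (NumberField.discr K : ℚ)).IsGloballyMinimal := hCd
  have hCMd : ¬ (Cd • W.quadraticTwist (NumberField.discr K : ℚ)).HasCM :=
    RamifiedPairUpperBound.not_hasCM_of_smul_quadraticTwist_eq hD0 rfl hCM
  obtain ⟨P₀, Hd, hP₀, hP₀K⟩ := exists_heegnerPoint_map_eq_derivedPoint_one hK hH d₁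
  have hPinf : ¬ IsOfFinAddOrder P₀ := by
    intro hfin
    apply hy
    rw [← hP₀K]
    exact (WeierstrassCurve.Affine.Point.map (W' := W)
      (algebraMap K (ringClassField K ι 1)).toRatAlgHom).isOfFinAddOrder hfin
  have hLK : LDerivEK W K ≠ 0 :=
    (lDerivEK_ne_zero_iff_not_isOfFinAddOrder W (W.conductorNorm ℤ) K (hGZ _ W K) hK hH ⟨Dt, Hd, ι, hP₀⟩).mpr hPinf
  have hL0 : W.entireLFunction 1 = 0 := entireLFunction_one_eq_zero_of_analyticRank_eq_one hr
  have hLt : (W.quadraticTwist (NumberField.discr K : ℚ)).entireLFunction 1 ≠ 0 := by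
    intro h0
    apply hLK
    rw [lDerivEK_eq_deriv_mul W K hmod hL0, h0, mul_zero]
  have hrt : (W.quadraticTwist (NumberField.discr K : ℚ)).analyticRank = 0 :=
    ((W.quadraticTwist _).analyticRank_eq_zero_iff_holds (hmod _)).mpr hLt
  have hrd : (Cd • W.quadraticTwist (NumberField.discr K : ℚ)).analyticRank = 0 := by
    rw [analyticRank_smul, hrt]
  have hBd : BSDp (Cd • W.quadraticTwist (NumberField.discr K : ℚ)) 2 := hZ _ hCMd hrd
  exact bsdp_two_of_card_sha_baseChange_eq_C_rankOne W K Dt β ι d₁ (Cd • W.quadraticTwist (NumberField.discr K : ℚ)) (hGZ _ W K)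
    hGZK hmod hMilneC hρ2 hc hr hK hodd h3 hH hy hdiv hndiv hshaC ⟨Cd, rfl⟩ hBd

/-! ### §4 The crux from the c-corrected K-side exactness, PRINT and rank-`0` `BSD₂` — Manin-free -/

/-- **Crux `RankOneAtTwoBigImageOddLocal` BY NAME, MANIN-FREE, from ONE K-side binder.**  Binders: PRINT — Gross–Zagier (`hGZ`), GZK
(`hGZK`), modularity as a newform (`hnf`), Hoffstein–Luo 1997 (`hHL`), Milne 1972 (`hMilneC`); `hXC` — the c-corrected `2`-part of
Gross's Conjecture (2.2) over `K` at conductor `1` on the slice's Kolyvagin-admissible doors: for `W` on the slice, `K` with odd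
`d_K ≠ −3`, the Heegner hypothesis, `d_K·(−|Δ|)`, `d_K·(−2|Δ|)` non-squares, EVERY datum `Dt` (any constant), `β`, `ι`, conductor-`1`
datum with `y_K` of infinite order and exact `2`-divisibility exponent `M₀`: `ord₂ #Ш(E_K)[2^∞] + 2 v₂(c_{Dt}) = 2 M₀`; and
`S_rankZeroTwin`.  The datum is modularity's (`nonempty_modularParametrizationData_iff_exists_isNewformOf_unconditional`), the door is
`exists_kolyvaginDoorField_of_analyticRank_eq_one` (p622543), `β`, `d₁`, `y_K` non-torsion and `M₀` as there.  No `S_manin`.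
BSD is not proved by this: conditional by design. [cite: GrossLMS1991, §2 Conj. (2.2) and §4] -/
theorem rankOneAtTwoBigImageOddLocal_of_shaExactCAtTwo
    (hGZ : ∀ (N : ℕ) [NeZero N] (W : WeierstrassCurve ℚ) (K : Type) [Field K] [NumberField K], gross_zagier N W K)
    (hGZK : rank_eq_analyticRank_of_analyticRank_le_one) (hnf : exists_isNewformOf)
    (hHL : HoffsteinLuo1997_exists_twist_L_one_ne_zero) (hMilneC : Milne1972.bsdQuotient_baseChange_quadratic_anyModel)
    (hXC : ∀ (W : WeierstrassCurve ℚ) [W.IsElliptic] [W.IsGloballyMinimal] [NeZero (W.conductorNorm ℤ)],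
      ¬ W.HasCM → (∀ n : ℕ, W.HasSurjectiveModNGaloisRep ((2 ^ n : ℕ) : ℤ)) → Odd W.tamagawaProduct → W.analyticRank = 1 →
      ∀ (K : Type) [Field K] [NumberField K], IsImaginaryQuadratic K → Odd (NumberField.discr K) →
        NumberField.discr K ≠ -3 → SatisfiesHeegnerHypothesis (W.conductorNorm ℤ) K →
        ¬ IsSquare ((NumberField.discr K : ℚ) * -|W.Δ|) → ¬ IsSquare ((NumberField.discr K : ℚ) * (-(2 * |W.Δ|))) →
        ∀ (Dt : ModularParametrizationData W (W.conductorNorm ℤ)) (β : ℤ) (ι : K →+* ℂ) (d₁ : KolyvaginHeegnerData Dt β ι 1),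
          ¬ IsOfFinAddOrder d₁.derivedPoint → ∀ (M₀ : ℕ),
          (∃ Q : (W.baseChange (ringClassField K ι 1)).toAffine.Point, ((2 ^ M₀ : ℕ) : ℤ) • Q = d₁.derivedPoint) →
          (¬ ∃ Q : (W.baseChange (ringClassField K ι 1)).toAffine.Point, ((2 ^ (M₀ + 1) : ℕ) : ℤ) • Q = d₁.derivedPoint) →
          (padicValNat 2 (Nat.card (AddCommGroup.primaryComponent (W.baseChange K).sha 2)) : ℤ) + 2 * padicValInt 2 Dt.c = 2 * M₀)
    (hZ : S_rankZeroTwin) : RankOneAtTwoBigImageOddLocal := by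
  intro W _ _ hCM hsurj hT hc hr
  haveI hN : NeZero (W.conductorNorm ℤ) := ⟨(W.conductorNorm_pos_holds).ne'⟩
  have hmod : hasEntireLFunction_rat := hasEntireLFunction_rat_of_exists_isNewformOf hnf
  -- the Kolyvagin-admissible door
  obtain ⟨K, _iF, _iN, hK, hodd, h3, hH, hsq1, hsq2, -, hLt, -⟩ :=
    exists_kolyvaginDoorField_of_analyticRank_eq_one hnf hHL W hr
  -- ANY datum (modularity), the orientation, the embedding, the conductor-`1` datum
  obtain ⟨Dt⟩ := (nonempty_modularParametrizationData_iff_exists_isNewformOf_unconditional.mpr hnf) W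
  obtain ⟨β, hβ⟩ : ∃ β : ℤ, (4 * (W.conductorNorm ℤ : ℕ) : ℤ) ∣ β ^ 2 - NumberField.discr K :=
    Literature.NumberTheory.QuadraticFields.Quadratic.exists_dvd_sq_sub_discr_of_ncard_primesOver hK.1 (NeZero.ne _) hH
  obtain ⟨ι⟩ : Nonempty (K →+* ℂ) := inferInstance
  obtain ⟨d₁⟩ := exists_kolyvaginHeegnerData_one
    (phi_heegnerTau_mem_singularModuliField_holds (W.conductorNorm ℤ) W K) hK Dt β ι hβ
  -- `y_K` has infinite order: `L'(W/K, 1) = L'(W, 1) · L(W^{(d_K)}, 1) ≠ 0` and Gross–Zagier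
  haveI hEK : (W.baseChange K).IsElliptic := isElliptic_baseChange' W K
  have hL0 : W.entireLFunction 1 = 0 := entireLFunction_one_eq_zero_of_analyticRank_eq_one hr
  obtain ⟨-, hderiv⟩ := leadingLCoeff_eq_deriv_of_analyticRank_eq_one hr
  have hLK : LDerivEK W K ≠ 0 := by
    rw [lDerivEK_eq_deriv_mul W K hmod hL0]; exact mul_ne_zero hderiv hLt
  obtain ⟨P₀, Hd, hP₀, hP₀K⟩ := exists_heegnerPoint_map_eq_derivedPoint_one hK hH d₁
  have hP₀inf : ¬ IsOfFinAddOrder P₀ :=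
    (lDerivEK_ne_zero_iff_not_isOfFinAddOrder W (W.conductorNorm ℤ) K (hGZ _ W K) hK hH ⟨Dt, Hd, ι, hP₀⟩).mp hLK
  have hy : ¬ IsOfFinAddOrder d₁.derivedPoint := by
    intro hfin
    apply hP₀inf
    rw [← hP₀K] at hfin
    exact (WeierstrassCurve.Affine.Point.map_injective (W' := W) _).isOfFinAddOrder_iff.mp hfin
  -- `M₀ = ord₂(y_K)` in `E(K[1])`
  obtain ⟨M₀, hdiv, hndiv⟩ : ∃ M₀ : ℕ,
      (∃ Q : (W.baseChange (ringClassField K ι 1)).toAffine.Point, ((2 ^ M₀ : ℕ) : ℤ) • Q = d₁.derivedPoint) ∧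
      ¬ ∃ Q : (W.baseChange (ringClassField K ι 1)).toAffine.Point, ((2 ^ (M₀ + 1) : ℕ) : ℤ) • Q = d₁.derivedPoint := by
    haveI : NumberField (ringClassField K ι 1) := numberField_ringClassField hK ι one_ne_zero
    haveI : (W.baseChange (ringClassField K ι 1)).IsElliptic := by rw [baseChange]; infer_instance
    haveI : Module.Finite ℤ (W.baseChange (ringClassField K ι 1)).toAffine.Point := by
      convert (W.baseChange (ringClassField K ι 1)).module_finite_point_holds
    exact exists_pow_smul_eq_and_not_of_not_isOfFinAddOrder Nat.prime_two hy
  -- the K-side exactness at this datum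
  have hshaC := hXC W hCM hsurj hc hr K hK hodd h3 hH hsq1 hsq2 Dt β ι d₁ hy M₀ hdiv hndiv
  exact bsdp_two_of_shaExactC_at hGZ hGZK hmod hMilneC hZ W hCM hsurj hc hr K hK hodd h3 hH Dt β ι d₁ hy M₀ hdiv hndiv hshaC

/-! ### §5 The Manin-free E-side conjecture AN-28c from `BSD₂` on the slice, hence from the K-side binder -/

/-- **`DoorIndexLawFullCAtTwo` (AN-28c) from `BSD₂` ON THE SLICE**, rank-`0` `BSD₂` of non-CM curves and PRINT (Gross–Zagier and
Kolyvagin at `(N_W, W, K)`, GZK, modularity): the `→` direction of the lead's `bsdp_two_iff_doorLawFullC_at` (p621746) at every door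
datum, with the PROVED Tamagawa law `doorTwistTamagawaAtTwo` and the Heegner hypothesis from admissibility.
[cite: GrossZagier1986, V.§2] [cite: Miller2011LMS, Def. 1.1] -/
theorem doorIndexLawFullCAtTwo_of_bsdp
    (hGZ : ∀ (N : ℕ) [NeZero N] (W : WeierstrassCurve ℚ) (K : Type) [Field K] [NumberField K], gross_zagier N W K)
    (hKo : ∀ (N : ℕ) [NeZero N] (W : WeierstrassCurve ℚ) (K : Type) [Field K] [NumberField K], kolyvagin N W K)
    (hGZK : rank_eq_analyticRank_of_analyticRank_le_one) (hmod : hasEntireLFunction_rat)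
    (hB : ∀ (W : WeierstrassCurve ℚ) [W.IsElliptic] [W.IsGloballyMinimal],
      ¬ W.HasCM → (∀ n : ℕ, W.HasSurjectiveModNGaloisRep ((2 ^ n : ℕ) : ℤ)) → Odd W.torsionOrder → Odd W.tamagawaProduct →
      W.analyticRank = 1 → BSDp W 2)
    (hZ : S_rankZeroTwin) : DoorIndexLawFullCAtTwo := by
  intro W _ _ _ hCM hsurj hT hc hr K _ _ hK hadm hLt Dt H ι P hP Wd _ _ Cd hWd
  have hBW : BSDp W 2 := hB W hCM hsurj hT hc hr
  have hD0 : (NumberField.discr K : ℚ) ≠ 0 := by exact_mod_cast NumberField.discr_ne_zero K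
  haveI hEt : (W.quadraticTwist (NumberField.discr K : ℚ)).IsElliptic := W.isElliptic_quadraticTwist hD0
  have hCMd : ¬ Wd.HasCM := RamifiedPairUpperBound.not_hasCM_of_smul_quadraticTwist_eq hD0 hWd hCM
  have hLd : Wd.entireLFunction 1 ≠ 0 := by rw [← hWd, entireLFunction_smul]; exact hLt
  have hrd : Wd.analyticRank = 0 := (Wd.analyticRank_eq_zero_iff_holds (hmod Wd)).2 hLd
  have hBd : BSDp Wd 2 := hZ Wd hCMd hrd
  have hHN : SatisfiesHeegnerHypothesis (W.conductorNorm ℤ) K := satisfiesHeegnerHypothesis_of_doorAdmissible W K hK hadm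
  exact (bsdp_two_iff_doorLawFullC_at hGZK hmod doorTwistTamagawaAtTwo W hT hc hr K hK (hGZ _ W K) (hKo _ W K) hadm hHN hLt Dt H
    ι P hP Wd Cd hWd hBd).2.2.mp hBW

/-- **AN-28c ⟸ the Manin-free K-side binder**: `DoorIndexLawFullCAtTwo` from PRINT (`hGZ`, `hKo`, `hGZK`, `hnf`, `hHL`, `hMilneC`),
the c-corrected K-side exactness `hXC` and `S_rankZeroTwin`, through `BSD₂` on the slice (§4) and `doorIndexLawFullCAtTwo_of_bsdp`.
BSD is not proved by this: conditional by design. [cite: GrossLMS1991, §2 Conj. (2.2)] -/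
theorem doorIndexLawFullCAtTwo_of_shaExactCAtTwo
    (hGZ : ∀ (N : ℕ) [NeZero N] (W : WeierstrassCurve ℚ) (K : Type) [Field K] [NumberField K], gross_zagier N W K)
    (hKo : ∀ (N : ℕ) [NeZero N] (W : WeierstrassCurve ℚ) (K : Type) [Field K] [NumberField K], kolyvagin N W K)
    (hGZK : rank_eq_analyticRank_of_analyticRank_le_one) (hnf : exists_isNewformOf)
    (hHL : HoffsteinLuo1997_exists_twist_L_one_ne_zero) (hMilneC : Milne1972.bsdQuotient_baseChange_quadratic_anyModel)
    (hXC : ∀ (W : WeierstrassCurve ℚ) [W.IsElliptic] [W.IsGloballyMinimal] [NeZero (W.conductorNorm ℤ)],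
      ¬ W.HasCM → (∀ n : ℕ, W.HasSurjectiveModNGaloisRep ((2 ^ n : ℕ) : ℤ)) → Odd W.tamagawaProduct → W.analyticRank = 1 →
      ∀ (K : Type) [Field K] [NumberField K], IsImaginaryQuadratic K → Odd (NumberField.discr K) →
        NumberField.discr K ≠ -3 → SatisfiesHeegnerHypothesis (W.conductorNorm ℤ) K →
        ¬ IsSquare ((NumberField.discr K : ℚ) * -|W.Δ|) → ¬ IsSquare ((NumberField.discr K : ℚ) * (-(2 * |W.Δ|))) →
        ∀ (Dt : ModularParametrizationData W (W.conductorNorm ℤ)) (β : ℤ) (ι : K →+* ℂ) (d₁ : KolyvaginHeegnerData Dt β ι 1),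
          ¬ IsOfFinAddOrder d₁.derivedPoint → ∀ (M₀ : ℕ),
          (∃ Q : (W.baseChange (ringClassField K ι 1)).toAffine.Point, ((2 ^ M₀ : ℕ) : ℤ) • Q = d₁.derivedPoint) →
          (¬ ∃ Q : (W.baseChange (ringClassField K ι 1)).toAffine.Point, ((2 ^ (M₀ + 1) : ℕ) : ℤ) • Q = d₁.derivedPoint) →
          (padicValNat 2 (Nat.card (AddCommGroup.primaryComponent (W.baseChange K).sha 2)) : ℤ) + 2 * padicValInt 2 Dt.c = 2 * M₀)
    (hZ : S_rankZeroTwin) : DoorIndexLawFullCAtTwo :=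
  doorIndexLawFullCAtTwo_of_bsdp hGZ hKo hGZK (hasEntireLFunction_rat_of_exists_isNewformOf hnf)
    (fun W _ _ hCM hsurj hT hc hr => rankOneAtTwoBigImageOddLocal_of_shaExactCAtTwo hGZ hGZK hnf hHL hMilneC hXC hZ W hCM hsurj hT hc hr)
    hZ

end Summit.BirchSwinnertonDyer.BirchSwinnertonDyer.Theorems.RankOneAtTwoOneDoor

end
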